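import Literature.Analysis.InnerProduct.LeviCivitaFour
import Mathlib.Analysis.InnerProductSpace.PiL2
import HarnessLib

/-!
# The Hodge dual of a 2-form along the position vector in `ℝ⁴`

Linear-algebra support file (everything proved; one definition, no named facts) for the `S³`
spectral block of A. Waldron, Invent. math. 217 (2019), Lemma 3.5(a): the vector
`u = ⋆(x ∧ W)`, `u_a = ½ ∑ ε_{abcd} x_b W_{cd}`, attached to a point `x ∈ ℝ⁴` and an antisymmetric
`W` (scalar- or vector-valued coefficients), and its two algebraic properties:

* `hodgeDual4`;
* `sum_sq_hodgeDual4` — **norm identity** `∑ₐ u_a² = ½|x|²‖W‖²_F − ‖W x‖²` (scalar coefficients),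
  so `= ½|x|²‖W‖²_F` for tangential `W` (`W x = 0`): on the unit sphere `|u|² = |W|²_{form}`;
* `rot_hodgeDual4` — **infinitesimal rotation equivariance**: for the elementary rotation
  `M = M_{ij}`, `(M u)_a = u(Mx, W)_a − u(x, S_M W)_a` with `(S_M W)_{cd} = W(Me_c, e_d) + W(e_c, Me_d)`;
  this is what makes `⋆` intertwine the total angular momenta `J = ∇_L − M` on vectors and
  `J = ∇_L + S` on 2-forms.
Both are finite identities over `Fin 4`, checked by expansion.

References: A. Waldron, Invent. math. 217 (2019), Lemma 3.5 [Waldron2019]; [folklore].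
-/

noncomputable section

open scoped BigOperators

namespace Literature.Analysis.InnerProduct

/-- The Hodge dual along `x`: `u_a = ½ ∑_{b,c,d} ε_{abcd} x_b W_{cd}`. [folklore] -/
def hodgeDual4 (x : Fin 4 → ℝ) (W : Fin 4 → Fin 4 → ℝ) (a : Fin 4) : ℝ :=
  (1 / 2) * ∑ b, ∑ c, ∑ d, (lc4 a b c d : ℝ) * x b * W c d

/-- Values of the symbol as real numbers (for `simp`). [folklore] -/
theorem lc4_cast (a b c d : Fin 4) : (lc4 a b c d : ℝ) =
    ((Int.sign (((b : ℤ) - a) * ((c : ℤ) - a) * ((d : ℤ) - a) * ((c : ℤ) - b) * ((d : ℤ) - b) *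
      ((d : ℤ) - c)) : ℤ) : ℝ) := rfl

/-- **Norm identity**: `∑ₐ u_a² = ½ |x|² ∑_{c,d} W_{cd}² − ∑_d (∑_c x_c W_{cd})²` for
antisymmetric `W`. [folklore] -/
theorem sum_sq_hodgeDual4 (x : Fin 4 → ℝ) (W : Fin 4 → Fin 4 → ℝ) (hW : ∀ c d, W c d = -W d c) :
    ∑ a, hodgeDual4 x W a ^ 2 =
      (1 / 2) * (∑ b, x b ^ 2) * (∑ c, ∑ d, W c d ^ 2) - ∑ d, (∑ c, x c * W c d) ^ 2 := by
  have h00 := hW 0 0; have h11 := hW 1 1; have h22 := hW 2 2; have h33 := hW 3 3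
  have h01 := hW 0 1; have h02 := hW 0 2; have h03 := hW 0 3
  have h12 := hW 1 2; have h13 := hW 1 3; have h23 := hW 2 3
  have e00 : W 0 0 = 0 := by linarith
  have e11 : W 1 1 = 0 := by linarith
  have e22 : W 2 2 = 0 := by linarith
  have e33 : W 3 3 = 0 := by linarith
  simp only [hodgeDual4, Fin.sum_univ_four, lc4_cast]
  simp only [Fin.isValue, Fin.val_zero, Fin.val_one, Fin.val_two, Nat.cast_zero, Nat.cast_one,
    Nat.cast_ofNat, show ((3 : Fin 4) : ℕ) = 3 from rfl]
  norm_num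
  simp only [show Int.sign 12 = 1 by decide, Int.cast_one]
  rw [h01, h02, h03, h12, h13, h23, e00, e11, e22, e33]
  ring

/-- The elementary rotation `M_{ij}` on coordinates: `(M x)_b = δ_{jb} x_i − δ_{ib} x_j`.
[folklore] -/
def rotVec (i j : Fin 4) (x : Fin 4 → ℝ) (b : Fin 4) : ℝ :=
  (if j = b then x i else 0) - (if i = b then x j else 0)

/-- The derivation action of `M_{ij}` on 2-index coefficients:
`(S W)_{cd} = W(Me_c, e_d) + W(e_c, Me_d) = δ_{ci}W_{jd} − δ_{cj}W_{id} + δ_{di}W_{cj} − δ_{dj}W_{ci}`.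
[folklore] -/
def rotForm (i j : Fin 4) (W : Fin 4 → Fin 4 → ℝ) (c d : Fin 4) : ℝ :=
  ((if c = i then W j d else 0) - (if c = j then W i d else 0)) +
    ((if d = i then W c j else 0) - (if d = j then W c i else 0))

/-- Kronecker delta as a real number. [folklore] -/
theorem δ4_cast (a b : Fin 4) : ((δ4 a b : ℤ) : ℝ) = if a = b then 1 else 0 := by
  unfold δ4; split_ifs <;> simp

/-- Normal form of the left-hand side `(M u)_a`. [folklore] -/
theorem rot_lhs_eq (x : Fin 4 → ℝ) (W : Fin 4 → Fin 4 → ℝ) (i j a : Fin 4) :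
    ((if j = a then hodgeDual4 x W i else 0) - (if i = a then hodgeDual4 x W j else 0)) =
      (1 / 2) * ∑ b, ∑ c, ∑ d,
        ((δ4 a j * lc4 i b c d - δ4 a i * lc4 j b c d : ℤ) : ℝ) * x b * W c d := by
  simp only [hodgeDual4]
  have h1 : (if j = a then (1 / 2 : ℝ) * ∑ b, ∑ c, ∑ d, (lc4 i b c d : ℝ) * x b * W c d else 0) =
      (1 / 2) * ∑ b, ∑ c, ∑ d, ((δ4 a j : ℤ) : ℝ) * ((lc4 i b c d : ℝ) * x b * W c d) := by
    rw [δ4_cast]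
    by_cases h : j = a
    · subst h; simp
    · simp [h, Ne.symm h]
  have h2 : (if i = a then (1 / 2 : ℝ) * ∑ b, ∑ c, ∑ d, (lc4 j b c d : ℝ) * x b * W c d else 0) =
      (1 / 2) * ∑ b, ∑ c, ∑ d, ((δ4 a i : ℤ) : ℝ) * ((lc4 j b c d : ℝ) * x b * W c d) := by
    rw [δ4_cast]
    by_cases h : i = a
    · subst h; simp
    · simp [h, Ne.symm h]
  rw [h1, h2, ← mul_sub, ← Finset.sum_sub_distrib]
  congr 1
  refine Finset.sum_congr rfl fun b _ => ?_
  rw [← Finset.sum_sub_distrib]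
  refine Finset.sum_congr rfl fun c _ => ?_
  rw [← Finset.sum_sub_distrib]
  refine Finset.sum_congr rfl fun d _ => ?_
  push_cast
  ring

/-- Normal form of `u(Mx, W)_a`. [folklore] -/
theorem hodgeDual4_rotVec (x : Fin 4 → ℝ) (W : Fin 4 → Fin 4 → ℝ) (i j a : Fin 4) :
    hodgeDual4 (rotVec i j x) W a =
      (1 / 2) * ∑ b, ∑ c, ∑ d,
        ((δ4 b i * lc4 a j c d - δ4 b j * lc4 a i c d : ℤ) : ℝ) * x b * W c d := by
  simp only [hodgeDual4, rotVec]
  congr 1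
  rw [Finset.sum_comm]
  conv_rhs => rw [Finset.sum_comm]
  refine Finset.sum_congr rfl fun c _ => ?_
  rw [Finset.sum_comm]
  conv_rhs => rw [Finset.sum_comm]
  refine Finset.sum_congr rfl fun d _ => ?_
  -- both sides equal `ε(a,j,c,d) x_i W_cd − ε(a,i,c,d) x_j W_cd`
  push_cast
  simp only [δ4_cast, mul_sub, sub_mul, mul_ite, ite_mul, one_mul, mul_zero, zero_mul,
    Finset.sum_sub_distrib, Finset.sum_ite_eq', Finset.sum_ite_eq, Finset.mem_univ, if_true]

/-- Normal form of `u(x, S W)_a`. [folklore] -/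
theorem hodgeDual4_rotForm (x : Fin 4 → ℝ) (W : Fin 4 → Fin 4 → ℝ) (i j a : Fin 4) :
    hodgeDual4 x (rotForm i j W) a =
      -((1 / 2) * ∑ b, ∑ c, ∑ d,
        ((δ4 c i * lc4 a b j d - δ4 c j * lc4 a b i d : ℤ) +
          (δ4 d i * lc4 a b c j - δ4 d j * lc4 a b c i : ℤ) : ℝ) * x b * W c d) := by
  simp only [hodgeDual4, rotForm]
  rw [← mul_neg, ← Finset.sum_neg_distrib]
  congr 1
  refine Finset.sum_congr rfl fun b _ => ?_
  -- the two groups of `rotForm`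
  have hc : ∀ d, ∑ c, (lc4 a b c d : ℝ) * x b *
      ((if c = i then W j d else 0) - (if c = j then W i d else 0)) =
      -∑ c, ((δ4 c i * lc4 a b j d - δ4 c j * lc4 a b i d : ℤ) : ℝ) * x b * W c d := by
    intro d
    push_cast
    simp only [δ4_cast, mul_sub, sub_mul, mul_ite, ite_mul, one_mul, mul_zero, zero_mul,
      Finset.sum_sub_distrib, Finset.sum_ite_eq', Finset.mem_univ, if_true]
    ring
  have hd : ∀ c, ∑ d, (lc4 a b c d : ℝ) * x b *
      ((if d = i then W c j else 0) - (if d = j then W c i else 0)) =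
      -∑ d, ((δ4 d i * lc4 a b c j - δ4 d j * lc4 a b c i : ℤ) : ℝ) * x b * W c d := by
    intro c
    push_cast
    simp only [δ4_cast, mul_sub, sub_mul, mul_ite, ite_mul, one_mul, mul_zero, zero_mul,
      Finset.sum_sub_distrib, Finset.sum_ite_eq', Finset.mem_univ, if_true]
    ring
  -- assemble
  calc ∑ c, ∑ d, (lc4 a b c d : ℝ) * x b *
        (((if c = i then W j d else 0) - (if c = j then W i d else 0)) +
          ((if d = i then W c j else 0) - (if d = j then W c i else 0)))
      = ∑ c, ∑ d, (lc4 a b c d : ℝ) * x b *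
            ((if c = i then W j d else 0) - (if c = j then W i d else 0)) +
          ∑ c, ∑ d, (lc4 a b c d : ℝ) * x b *
            ((if d = i then W c j else 0) - (if d = j then W c i else 0)) := by
        simp only [mul_add, Finset.sum_add_distrib]
    _ = ∑ d, ∑ c, (lc4 a b c d : ℝ) * x b *
            ((if c = i then W j d else 0) - (if c = j then W i d else 0)) +
          ∑ c, ∑ d, (lc4 a b c d : ℝ) * x b *
            ((if d = i then W c j else 0) - (if d = j then W c i else 0)) := by
        rw [Finset.sum_comm]
    _ = ∑ d, -∑ c, ((δ4 c i * lc4 a b j d - δ4 c j * lc4 a b i d : ℤ) : ℝ) * x b * W c d +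
          ∑ c, -∑ d, ((δ4 d i * lc4 a b c j - δ4 d j * lc4 a b c i : ℤ) : ℝ) * x b * W c d := by
        rw [Finset.sum_congr rfl fun d _ => hc d, Finset.sum_congr rfl fun c _ => hd c]
    _ = -∑ c, ∑ d, (((δ4 c i * lc4 a b j d - δ4 c j * lc4 a b i d : ℤ) +
          (δ4 d i * lc4 a b c j - δ4 d j * lc4 a b c i : ℤ) : ℝ) * x b * W c d) := by
        rw [Finset.sum_neg_distrib, Finset.sum_neg_distrib, Finset.sum_comm, ← neg_add,
          ← Finset.sum_add_distrib]
        congr 1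
        refine Finset.sum_congr rfl fun c _ => ?_
        rw [← Finset.sum_add_distrib]
        refine Finset.sum_congr rfl fun d _ => ?_
        push_cast
        ring

/-- **Infinitesimal rotation equivariance of the Hodge dual**:
`(M_{ij} u)_a = u(M_{ij}x, W)_a − u(x, S_{ij}W)_a`, where `(M u)_a = δ_{ja}u_i − δ_{ia}u_j`
(from `lc4_derivation`). [folklore] -/
theorem rot_hodgeDual4 (x : Fin 4 → ℝ) (W : Fin 4 → Fin 4 → ℝ) (i j a : Fin 4) :
    ((if j = a then hodgeDual4 x W i else 0) - (if i = a then hodgeDual4 x W j else 0)) =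
      hodgeDual4 (rotVec i j x) W a - hodgeDual4 x (rotForm i j W) a := by
  rw [rot_lhs_eq, hodgeDual4_rotVec, hodgeDual4_rotForm, sub_neg_eq_add, ← mul_add,
    ← Finset.sum_add_distrib]
  congr 1
  refine Finset.sum_congr rfl fun b _ => ?_
  rw [← Finset.sum_add_distrib]
  refine Finset.sum_congr rfl fun c _ => ?_
  rw [← Finset.sum_add_distrib]
  refine Finset.sum_congr rfl fun d _ => ?_
  have h := lc4_derivation i j a b c d
  have hI : (δ4 a j * lc4 i b c d - δ4 a i * lc4 j b c d : ℤ) =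
      (δ4 b i * lc4 a j c d - δ4 b j * lc4 a i c d) +
        ((δ4 c i * lc4 a b j d - δ4 c j * lc4 a b i d) + (δ4 d i * lc4 a b c j - δ4 d j * lc4 a b c i)) := by
    linarith
  rw [hI]
  push_cast
  ring

/-! ### Vector-valued coefficients -/

section VectorValued

open scoped RealInnerProductSpace

variable {V : Type*} [NormedAddCommGroup V] [InnerProductSpace ℝ V]

/-- The Hodge dual along `x` for vector-valued coefficients. [folklore] -/
def hodgeDualV (x : Fin 4 → ℝ) (W : Fin 4 → Fin 4 → V) (a : Fin 4) : V :=
  (1 / 2 : ℝ) • ∑ b, ∑ c, ∑ d, ((lc4 a b c d : ℝ) * x b) • W c d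

/-- Components: `⟨u_a, v⟩ = u(x, ⟨W, v⟩)_a`. [folklore] -/
theorem inner_hodgeDualV (x : Fin 4 → ℝ) (W : Fin 4 → Fin 4 → V) (a : Fin 4) (v : V) :
    ⟪hodgeDualV x W a, v⟫ = hodgeDual4 x (fun c d => ⟪W c d, v⟫) a := by
  simp only [hodgeDualV, hodgeDual4, inner_smul_left, sum_inner, RCLike.conj_to_real]

/-- The derivation action `S_{ij}` on vector-valued 2-index coefficients. [folklore] -/
def rotFormV (i j : Fin 4) (W : Fin 4 → Fin 4 → V) (c d : Fin 4) : V :=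
  ((if c = i then W j d else 0) - (if c = j then W i d else 0)) +
    ((if d = i then W c j else 0) - (if d = j then W c i else 0))

/-- Components of `S_{ij} W`. [folklore] -/
theorem inner_rotFormV (i j : Fin 4) (W : Fin 4 → Fin 4 → V) (c d : Fin 4) (v : V) :
    ⟪rotFormV i j W c d, v⟫ = rotForm i j (fun c d => ⟪W c d, v⟫) c d := by
  simp only [rotFormV, rotForm, inner_add_left, inner_sub_left, apply_ite (fun w : V => ⟪w, v⟫),
    inner_zero_left]

/-- **Rotation equivariance, vector-valued coefficients.** [folklore] -/
theorem rot_hodgeDualV (x : Fin 4 → ℝ) (W : Fin 4 → Fin 4 → V) (i j a : Fin 4) :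
    ((if j = a then hodgeDualV x W i else 0) - (if i = a then hodgeDualV x W j else 0)) =
      hodgeDualV (rotVec i j x) W a - hodgeDualV x (rotFormV i j W) a := by
  refine ext_inner_right ℝ fun v => ?_
  have h := rot_hodgeDual4 x (fun c d => ⟪W c d, v⟫) i j a
  simp only [inner_sub_left, inner_hodgeDualV]
  have h1 : ⟪(if j = a then hodgeDualV x W i else 0), v⟫ =
      (if j = a then hodgeDual4 x (fun c d => ⟪W c d, v⟫) i else 0) := by
    split_ifs <;> simp [inner_hodgeDualV]
  have h2 : ⟪(if i = a then hodgeDualV x W j else 0), v⟫ =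
      (if i = a then hodgeDual4 x (fun c d => ⟪W c d, v⟫) j else 0) := by
    split_ifs <;> simp [inner_hodgeDualV]
  rw [h1, h2, h]
  congr 1
  simp only [hodgeDual4]
  congr 1
  refine Finset.sum_congr rfl fun b _ => Finset.sum_congr rfl fun c _ =>
    Finset.sum_congr rfl fun d _ => ?_
  rw [inner_rotFormV]

/-- **Norm identity, vector-valued coefficients** (finite-dimensional `V`): for antisymmetric `W`,
`∑ₐ ‖u_a‖² = ½ |x|² ∑_{c,d} ‖W_{cd}‖² − ∑_d ‖∑_c x_c W_{cd}‖²`. [folklore] -/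
theorem sum_norm_sq_hodgeDualV [FiniteDimensional ℝ V] (x : Fin 4 → ℝ) (W : Fin 4 → Fin 4 → V)
    (hW : ∀ c d, W c d = -W d c) :
    ∑ a, ‖hodgeDualV x W a‖ ^ 2 =
      (1 / 2) * (∑ b, x b ^ 2) * (∑ c, ∑ d, ‖W c d‖ ^ 2) - ∑ d, ‖∑ c, x c • W c d‖ ^ 2 := by
  set e := stdOrthonormalBasis ℝ V with he
  -- Parseval for every vector
  have hP : ∀ y : V, ‖y‖ ^ 2 = ∑ k, ⟪y, e k⟫ ^ 2 := fun y => (e.sum_sq_inner_left y).symm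
  -- scalar identity for each component
  have hk : ∀ k, ∑ a, ⟪hodgeDualV x W a, e k⟫ ^ 2 =
      (1 / 2) * (∑ b, x b ^ 2) * (∑ c, ∑ d, ⟪W c d, e k⟫ ^ 2) - ∑ d, (∑ c, x c * ⟪W c d, e k⟫) ^ 2 := by
    intro k
    simp_rw [inner_hodgeDualV]
    exact sum_sq_hodgeDual4 x (fun c d => ⟪W c d, e k⟫) fun c d => by rw [hW c d, inner_neg_left]
  -- sum over `k`
  simp_rw [hP]
  rw [Finset.sum_comm]
  simp_rw [hk, Finset.sum_sub_distrib, ← Finset.mul_sum]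
  congr 1
  · congr 1
    rw [Finset.sum_comm]
    refine Finset.sum_congr rfl fun c _ => ?_
    rw [Finset.sum_comm]
  · rw [Finset.sum_comm]
    refine Finset.sum_congr rfl fun d _ => Finset.sum_congr rfl fun k _ => ?_
    rw [sum_inner]
    simp only [inner_smul_left, RCLike.conj_to_real]

end VectorValued

end Literature.Analysis.InnerProduct
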